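import Mathlib
import HarnessLib
import Literature.Analysis.FluidPDE.TypeIAncientMild
import Literature.Analysis.FluidPDE.VorticityCalculus
import Summits.NavierStokesRegularity.NavierStokesRegularity.Theorems.PoloidalWindowDoorPoloidalWindowRigidityHotLoopCore
import Summits.NavierStokesRegularity.NavierStokesRegularity.Theorems.PoloidalWindowDoorPoloidalWindowRigidityConstantShearMeans
import Summits.NavierStokesRegularity.NavierStokesRegularity.Theorems.PoloidalWindowDoorPoloidalWindowRigidityWindow
import Summits.NavierStokesRegularity.NavierStokesRegularity.Theorems.PoloidalWindowDoorPoloidalWindowRigidityFirstIntegral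

/-!
# Route `PoloidalWindowDoor`, crux `PoloidalWindowRigidity` (K2, stmt-NavierStokesRegularity-19708) — HOT LOOPS: an
# isolated compact hot piece of a poloidal class profile that is not touched by planar vorticity zeros is ringed by a
# non-stationary CLOSED VORTEX LINE (stub HL1 `stub_hotLoop` of line `hot_loops` v1, ns-idea-8 g6; = the null-free
# sub-cell of v2's HP1 `stub_islandOrNull`)

Cell ns-regularity-ideate, seat ns-poloidal-K2-p2 g11 (stub-worker on K2; `--supports` the crux item).

* `hotLoop_of_nullFree` — VERBATIM the v1 stub HL1: class profile, poloidal, `N = v₂(−1,0) ≠ 0`, `√(−t)|v₂| ≤ |N|`, an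
  admissible pair `(K, O)` (compact `K ∋ 0` of hot points of the plane `{y₂ = 0}`, open `O ⊇ K` whose hot planar points lie
  in `K`) with `curl v(−1) ≠ 0` on `(O ∩ plane) ∖ K` ⇒ a periodic orbit of `y′ = curl v(−1)(y)` with positive period through a
  point where `curl v(−1) ≠ 0`.  Proof: the hot-loop lemma `…HotLoopCore.exists_periodic_orbit_of_isolated_hot_piece` for the
  horizontal `C²` field `X = curl v(−1)` (poloidal: `X₂ ≡ 0`) and the first integral `f = ±v₂(−1,·)` (sign of `N`; frozen law
  `…FirstIntegral.stub_firstIntegral`).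
* `hotLoop_of_nullFree_at` — the same at any time `s < 0`, plane `{y₂ = z₀}`, sign `σ = ±1` and level `M` (the binders of v2's
  HP1 `stub_islandOrNull` plus null-freeness): the null-free sub-cell of HP1's dichotomy, closed.

The complementary sub-cell of HP1 (a planar vorticity zero on `(O ∩ plane) ∖ K`; v2 concludes «loop or irrotational planar
disc» there by a continuum argument) is NOT proved here: the cut-off level-curve datum of `…HotLoopCore` needs the sign of
the level function on the transition collar, which is available for `f = ±v₂` around the hot piece but not for the stream
function `ψ` around one of its level circles (inside/outside information of Jordan type).

WHAT THIS IS NOT: not a claim about Navier–Stokes regularity, not K2/S3 — a provable lemma of an ideator line about HYPOTHETICAL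
poloidal Type-I blow-up profiles; the line's dead cell rests on the named wall S6G (item 27893) via the proved
`LoopPeriodRatchet.NoLoopsOfGrowth`.  bears_on LADDER-NS N0, rung N0-LocalTubeDoorPoloidal.
-/

noncomputable section

-- the summit and its single sub-problem share the name (CONVENTIONS §1), as in every Theorems file
set_option linter.dupNamespace false

namespace Summit.NavierStokesRegularity.NavierStokesRegularity.Theorems.PoloidalWindowDoorPoloidalWindowRigidityHotLoop

open MeasureTheory Set Function Filter Topology Metric
open scoped RealInnerProductSpace InnerProductSpace
open Literature.Analysis Literature.Analysis.FluidPDE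
open Summit.NavierStokesRegularity.NavierStokesRegularity.Theorems.PoloidalWindowDoorPoloidalWindowRigidityConstantShearMeans
open Summit.NavierStokesRegularity.NavierStokesRegularity.Theorems.PoloidalWindowDoorPoloidalWindowRigidityWindow
open Summit.NavierStokesRegularity.NavierStokesRegularity.Theorems.PoloidalWindowDoorPoloidalWindowRigidityFirstIntegral
open Summit.NavierStokesRegularity.NavierStokesRegularity.Theorems.PoloidalWindowDoorPoloidalWindowRigidityHotLoopCore

variable {C : ℝ} {v : ℝ → EuclideanSpace ℝ (Fin 3) → EuclideanSpace ℝ (Fin 3)}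

/-- **Hot loops at any time, plane and sign (the null-free sub-cell of HP1 `stub_islandOrNull`).**  For a poloidal profile of
the route's Type-I class, a time `s < 0`, a height `z₀`, a factor `σ` (in HP1: `σ = ±1`), a level `M`, a compact nonempty `K ⊂ {y₂ = z₀}` with
`σv₂(s,·) = M` on `K`, an open `O ⊇ K` with `σv₂(s,·) ≤ M` on `O ∩ {y₂ = z₀}` and all level-`M` points of `O ∩ {y₂ = z₀}` in `K`:
if `curl v(s) ≠ 0` on `(O ∩ {y₂ = z₀}) ∖ K`, then `y′ = curl v(s)(y)` has a non-stationary periodic orbit. -/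
theorem hotLoop_of_nullFree_at (hrate : HasTypeITimeDecay C v)
    (hcont : ContinuousOn (uncurry v) (Iio (0 : ℝ) ×ˢ univ))
    (hmild : ∀ s t : ℝ, s < t → t < 0 → ∀ x,
      v t x = UnboundedOperators.heatExtension (v s) (t - s) x - oseenDuhamel 1 s v v t x)
    (hdiv : ∀ t < 0, VectorCalculus.IsDivFree (v t))
    (hpol : ∀ s < 0, ∀ y, ⟪curl (v s) y, EuclideanSpace.single 2 1⟫_ℝ = 0)
    {s z₀ σ M : ℝ} {K O : Set (EuclideanSpace ℝ (Fin 3))} (hs : s < 0)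
    (hK : IsCompact K) (hKne : K.Nonempty) (hKM : ∀ y ∈ K, y 2 = z₀ ∧ σ * v s y 2 = M) (hO : IsOpen O) (hKO : K ⊆ O)
    (hle : ∀ y ∈ O, y 2 = z₀ → σ * v s y 2 ≤ M) (hiso : ∀ y ∈ O, y 2 = z₀ → σ * v s y 2 = M → y ∈ K)
    (hnull : ∀ y ∈ O, y 2 = z₀ → y ∉ K → curl (v s) y ≠ 0) :
    ∃ (γ : ℝ → EuclideanSpace ℝ (Fin 3)) (ℓ : ℝ), 0 < ℓ ∧ (∀ θ, HasDerivAt γ (curl (v s) (γ θ)) θ) ∧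
      (∀ θ, γ (θ + ℓ) = γ θ) ∧ curl (v s) (γ 0) ≠ 0 := by
  obtain ⟨y₀, hy₀⟩ := hKne
  have hy₀2 : y₀ 2 = z₀ := (hKM y₀ hy₀).1
  -- smoothness of the slice and of its curl; poloidality; the frozen law
  have hA : IsTypeIAncientMild C v := isTypeIAncientMild_of_class hrate hcont hmild hdiv
  have hvs : ContDiff ℝ (⊤ : ℕ∞) (v s) := hA.contDiff_slice hs
  have hV3 : ContDiff ℝ 3 (v s) := contDiff_infty.1 hvs 3
  have hVd : Differentiable ℝ (v s) := hV3.differentiable (by norm_num)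
  have hX : ContDiff ℝ 2 (curl (v s)) := contDiff_curl (n := 2) (by exact_mod_cast hV3)
  have hX2 : ∀ y, curl (v s) y 2 = 0 := fun y => by
    simpa [EuclideanSpace.inner_single_right] using hpol s hs y
  have hfrozen : ∀ y, fderiv ℝ (v s) y (curl (v s) y) 2 = 0 := fun y => by
    have h := stub_firstIntegral C v hrate hcont hmild hdiv (EuclideanSpace.single 2 1) hpol s hs y
    simpa [EuclideanSpace.inner_single_right] using h
  -- the first integral `f = σ v₂(s,·)`
  have hf3 : ContDiff ℝ 3 (fun y => σ * v s y 2) := contDiff_const.mul (contDiff_coord hV3 2)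
  have hfX : ∀ y, fderiv ℝ (fun y => σ * v s y 2) y (curl (v s) y) = 0 := fun y => by
    rw [fderiv_const_mul ((contDiff_coord hV3 2).differentiable (by norm_num) y)]
    simp only [FunLike.coe_smul, Pi.smul_apply, smul_eq_mul]
    rw [fderiv_coord_apply (hVd y) 2, hfrozen, mul_zero]
  have hfle : ∀ y : EuclideanSpace ℝ (Fin 3), y 2 = y₀ 2 → y ∈ O → σ * v s y 2 ≤ M := fun y hy hyO =>
    hle y hyO (hy.trans hy₀2)
  have hKf : ∀ y ∈ K, y 2 = y₀ 2 ∧ σ * v s y 2 = M := fun y hy => ⟨(hKM y hy).1.trans hy₀2.symm, (hKM y hy).2⟩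
  have hiso' : ∀ y ∈ O, y 2 = y₀ 2 → σ * v s y 2 = M → y ∈ K := fun y hy hy2 => hiso y hy (hy2.trans hy₀2)
  have hXne : ∀ y ∈ O, y 2 = y₀ 2 → y ∉ K → curl (v s) y ≠ 0 := fun y hy hy2 => hnull y hy (hy2.trans hy₀2)
  exact exists_periodic_orbit_of_isolated_hot_piece hX hX2 hf3 hfX hK hy₀ hKf hO hKO hfle hiso' hXne

/-- **STUB HL1 `stub_hotLoop` of line `hot_loops` v1 (VERBATIM): COMPACT HOT SETS SHED LOOPS.**  For a poloidal profile of the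
route's Type-I class, hot-spot normalised at `(−1,0)` (`N = v₂(−1,0) ≠ 0`, `√(−t)|v₂| ≤ |N|`), every admissible pair `(K, O)` —
`K ∋ 0` a compact set of hot points of the plane `{y₂ = 0}`, `O ⊇ K` open with all hot planar points of `O` in `K` — on which
the vorticity has no planar zero off `K` carries a non-stationary closed vortex line. -/
theorem hotLoop_of_nullFree :
    ∀ (C : ℝ) (v : ℝ → EuclideanSpace ℝ (Fin 3) → EuclideanSpace ℝ (Fin 3)),
      Literature.Analysis.FluidPDE.HasTypeITimeDecay C v →
      ContinuousOn (Function.uncurry v) (Set.Iio (0 : ℝ) ×ˢ Set.univ) →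
      (∀ s t : ℝ, s < t → t < 0 → ∀ x, v t x =
        Literature.Analysis.UnboundedOperators.heatExtension (v s) (t - s) x -
          Literature.Analysis.FluidPDE.oseenDuhamel 1 s v v t x) →
      (∀ t < 0, Literature.Analysis.FluidPDE.VectorCalculus.IsDivFree (v t)) →
      (∀ s < 0, ∀ y, ⟪Literature.Analysis.FluidPDE.curl (v s) y, EuclideanSpace.single 2 1⟫_ℝ = 0) →
      v (-1) 0 2 ≠ 0 → (∀ t < 0, ∀ x, Real.sqrt (-t) * |v t x 2| ≤ |v (-1) 0 2|) →
      ∀ K O : Set (EuclideanSpace ℝ (Fin 3)),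
        (IsCompact K ∧ (0 : EuclideanSpace ℝ (Fin 3)) ∈ K ∧ (∀ y ∈ K, y 2 = 0 ∧ v (-1) y 2 = v (-1) 0 2) ∧
            IsOpen O ∧ K ⊆ O ∧ (∀ y ∈ O, y 2 = 0 → v (-1) y 2 = v (-1) 0 2 → y ∈ K)) →
        (∀ y ∈ O, y 2 = 0 → y ∉ K → Literature.Analysis.FluidPDE.curl (v (-1)) y ≠ 0) →
        ∃ (γ : ℝ → EuclideanSpace ℝ (Fin 3)) (ℓ : ℝ), 0 < ℓ ∧
          (∀ θ, HasDerivAt γ (Literature.Analysis.FluidPDE.curl (v (-1)) (γ θ)) θ) ∧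
          (∀ θ, γ (θ + ℓ) = γ θ) ∧ Literature.Analysis.FluidPDE.curl (v (-1)) (γ 0) ≠ 0 := by
  intro C v hrate hcont hmild hdiv hpol hN hsup K O hadm hnull
  obtain ⟨hKc, h0K, hKhot, hO, hKO, hiso⟩ := hadm
  have hext : ∀ y, |v (-1) y 2| ≤ |v (-1) 0 2| := fun y => by
    simpa using hsup (-1) (by norm_num) y
  rcases lt_or_gt_of_ne hN with hneg | hpos
  · -- `N < 0`: `σ = -1`, `M = -N`
    refine hotLoop_of_nullFree_at hrate hcont hmild hdiv hpol (s := -1) (z₀ := 0) (σ := -1) (M := -v (-1) 0 2)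
      (by norm_num) hKc ⟨0, h0K⟩ (fun y hy => ⟨(hKhot y hy).1, by rw [(hKhot y hy).2]; ring⟩) hO hKO
      (fun y _ _ => ?_) (fun y hy hy2 hval => hiso y hy hy2 (by linarith)) hnull
    have h := hext y
    rw [abs_of_neg hneg] at h
    linarith [neg_abs_le (v (-1) y 2)]
  · -- `N > 0`: `σ = 1`, `M = N`
    refine hotLoop_of_nullFree_at hrate hcont hmild hdiv hpol (s := -1) (z₀ := 0) (σ := 1) (M := v (-1) 0 2)
      (by norm_num) hKc ⟨0, h0K⟩ (fun y hy => ⟨(hKhot y hy).1, by rw [(hKhot y hy).2]; ring⟩) hO hKO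
      (fun y _ _ => ?_) (fun y hy hy2 hval => hiso y hy hy2 (by linarith)) hnull
    have h := hext y
    rw [abs_of_pos hpos] at h
    linarith [le_abs_self (v (-1) y 2)]

end Summit.NavierStokesRegularity.NavierStokesRegularity.Theorems.PoloidalWindowDoorPoloidalWindowRigidityHotLoop

end
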